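import Summits.Ventures.PercRepro.SevenThreeStarFibre

/-!
# PercRepro — the `(7,3)` cell: the realisability of a star datum (p3, gen 16)

For a series class `N` of the world meeting `W`, the cyclic part `K_N = E ∖ (N ∪ L₀)` of its fibre has nullity two and
no coloops (`kN_nullity_two`, `kN_coloopFree`), `|K_N| = 10 − t_P − c_P − ℓ₀` (`card_kN`), and every series class
`N_i` of `K_N` has a circuit complement `C_i = K_N ∖ N_i`: `ρ(C_i) + 1 = |C_i|` with at least `3` points, at least `2`
of them in `W` (else a point of `W` would be spanned by `T`) and at least one in `T` (else `C_i ⊆ W` would be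
independent) — `class_bounds`. These are exactly the flat conditions behind the table's `realisable` guard
(`P3-C025-seven-three-plan.md` §6, M6 / §9 (R4)): `|N_i| + t_P + c_P + ℓ₀ ≤ 7`, `|N_i ∩ W| + c_P + ℓ₀ ≤ 5`,
`|N_i ∩ T| + t_P ≤ 2`, and `Σ_i |N_i ∩ T| = 3 − t_P` (`sum_card_inter_T`). Also `t_P ≤ 1` (`card_inter_T_le_one`:
two points of `T` are never in series) and `K_N` has at least two classes (`two_le_card_serClasses_kN`).
-/

namespace PercRepro

namespace SevenThree

open Finset ThmH SixThree

variable {α : Type*} [DecidableEq α] {M : Matroid α} [M.Finite]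

omit [DecidableEq α] in
/-- Subsets of `T` are independent: `nrk A = |A|` for `A ⊆ T`. -/
theorem nrk_subset_T {T W A : Finset α} (h : ReducedWorld M T W) (hA : A ⊆ T) : nrk M A = A.card := by
  have hT : M.Indep (T : Set α) := by
    rw [Matroid.indep_iff_eRk_eq_encard_of_finite (Finset.finite_toSet T), h.T_rank,
      Set.encard_coe_eq_coe_finsetCard, h.T_card]
    rfl
  apply nrk_eq_of_eRk
  rw [(hT.subset (Finset.coe_subset.2 hA)).eRk_eq_encard, Set.encard_coe_eq_coe_finsetCard]

omit [DecidableEq α] in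
/-- Subsets of `W` are independent: `nrk A = |A|` for `A ⊆ W`. -/
theorem nrk_subset_W {T W A : Finset α} (h : ReducedWorld M T W) (hA : A ⊆ W) : nrk M A = A.card := by
  apply nrk_eq_of_eRk
  rw [(h.W_indep.subset (Finset.coe_subset.2 hA)).eRk_eq_encard, Set.encard_coe_eq_coe_finsetCard]

/-- In a simple matroid a dependent finset of the ground set has at least three points (the world has two points, so
every singleton has rank `1`). -/
theorem three_le_card_of_dep {T W C : Finset α} (h : ReducedWorld M T W) (hC : C ⊆ T ∪ W) (hdep : nrk M C < C.card) :
    3 ≤ C.card := by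
  by_contra hlt
  have hle : C.card ≤ 2 := by omega
  rcases Nat.lt_or_ge C.card 2 with h1 | h2
  · rcases Nat.lt_or_ge C.card 1 with h0 | h0'
    · have : C = ∅ := Finset.card_eq_zero.1 (by omega)
      subst this
      simp at hdep
    · -- a singleton: rank `1` via a second point of the world
      obtain ⟨e, he⟩ : ∃ e, C = {e} := Finset.card_eq_one.1 (by omega)
      have heC : e ∈ C := by rw [he]; exact Finset.mem_singleton_self e
      have heE : e ∈ gr M := world_subset h (hC heC)
      obtain ⟨t, ht⟩ : T.Nonempty := Finset.card_pos.1 (by rw [h.T_card]; norm_num)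
      obtain ⟨w, hw⟩ : W.Nonempty := Finset.card_pos.1 (by rw [h.W_card]; norm_num)
      -- pick `f ≠ e` in the world
      obtain ⟨f, hfE, hfe⟩ : ∃ f ∈ gr M, f ≠ e := by
        by_cases hte : t = e
        · refine ⟨w, h.W_sub hw, fun hh => ?_⟩
          rw [hh, ← hte] at hw
          exact Finset.disjoint_left.1 h.disj ht hw
        · exact ⟨t, h.T_sub ht, hte⟩
      have hs := h.simple e (by rw [← coe_gr M]; exact_mod_cast heE) f (by rw [← coe_gr M]; exact_mod_cast hfE)
        (Ne.symm hfe)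
      have h2 : nrk M {e, f} = 2 := by
        apply nrk_eq_of_eRk
        rw [Finset.coe_pair]
        exact hs
      have h3 := nrk_le_nrk_sdiff_add_card (M := M) {e, f} {f}
      have hsd : ({e, f} : Finset α) \ {f} = {e} := by
        ext x
        simp only [Finset.mem_sdiff, Finset.mem_insert, Finset.mem_singleton]
        constructor
        · rintro ⟨hx | hx, hxf⟩
          · exact hx
          · exact absurd hx hxf
        · rintro rfl
          exact ⟨Or.inl rfl, fun hh => hfe hh.symm⟩
      rw [hsd, Finset.card_singleton] at h3
      simp only [he, Finset.card_singleton] at hdep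
      omega
  · -- a pair: rank `2` by simplicity
    obtain ⟨e, f, hef, hC'⟩ := Finset.card_eq_two.1 (by omega : C.card = 2)
    subst hC'
    have heE : e ∈ gr M := world_subset h (hC (Finset.mem_insert_self e {f}))
    have hfE : f ∈ gr M := world_subset h (hC (Finset.mem_insert_of_mem (Finset.mem_singleton_self f)))
    have hs := h.simple e (by rw [← coe_gr M]; exact_mod_cast heE) f (by rw [← coe_gr M]; exact_mod_cast hfE) hef
    have h2 : nrk M {e, f} = 2 := by
      apply nrk_eq_of_eRk
      rw [Finset.coe_pair]
      exact hs
    rw [Finset.card_pair hef] at hdep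
    omega

/-- Two points of `T` are never in series in the world (`E ∖ {t, t'} ⊇ W` has rank `7`). -/
theorem card_inter_T_le_one {T W N : Finset α} (h : ReducedWorld M T W) (hr : M.eRank = 7)
    (hN : N ∈ serClasses M (T ∪ W)) : (N ∩ T).card ≤ 1 := by
  by_contra hcon
  obtain ⟨t, ht, t', ht', hne⟩ := Finset.one_lt_card.1 (by omega : 1 < (N ∩ T).card)
  rw [Finset.mem_inter] at ht ht'
  have hE := world_subset h
  obtain ⟨e, he, rfl⟩ := mem_serClasses.1 hN
  have hser : Ser M (T ∪ W) t t' := ser_of_mem_serClass hE he ht.1 ht'.1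
  rcases hser with hh | hh
  · exact hne hh
  · have hW : W ⊆ (T ∪ W) \ {t, t'} := by
      intro w hw
      rw [Finset.mem_sdiff, Finset.mem_insert, Finset.mem_singleton]
      refine ⟨Finset.mem_union_right T hw, ?_⟩
      rintro (rfl | rfl)
      · exact Finset.disjoint_left.1 h.disj ht.2 hw
      · exact Finset.disjoint_left.1 h.disj ht'.2 hw
    have h1 : nrk M W ≤ nrk M ((T ∪ W) \ {t, t'}) := nrk_mono hW
    rw [nrk_subset_W h (Finset.Subset.refl W), h.W_card, nrk_world h hr] at *
    omega

/-- `K_N` is the cyclic part of a witness of the fibre: nullity two, coloop-free, in the ground set. -/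
theorem kN_facts {T W N : Finset α} (h : ReducedWorld M T W) (hr : M.eRank = 7) (hN : N ∈ serClasses M (T ∪ W))
    (hNW : (N ∩ W).Nonempty) :
    (T ∪ W) \ (N ∪ coloopsOf M (T ∪ W)) ⊆ gr M ∧
      nrk M ((T ∪ W) \ (N ∪ coloopsOf M (T ∪ W))) + 2 = ((T ∪ W) \ (N ∪ coloopsOf M (T ∪ W))).card ∧
      cyclicPart M ((T ∪ W) \ (N ∪ coloopsOf M (T ∪ W))) = (T ∪ W) \ (N ∪ coloopsOf M (T ∪ W)) := by
  obtain ⟨w, hw⟩ := hNW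
  rw [Finset.mem_inter] at hw
  have hZ : ({w} : Finset α) ⊆ (N ∩ W) ∪ coloopsOf M (T ∪ W) :=
    Finset.singleton_subset_iff.2 (Finset.mem_union_left _ (Finset.mem_inter.2 hw))
  have hZN : (({w} : Finset α) ∩ N).Nonempty := ⟨w, Finset.mem_inter.2 ⟨Finset.mem_singleton_self w, hw.1⟩⟩
  obtain ⟨-, hnul, -, -, hcyc⟩ := star_witness_data h hr hN hZ hZN
  have hS : T ∪ (W \ {w}) ⊆ gr M := Finset.union_subset h.T_sub (Finset.sdiff_subset.trans h.W_sub)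
  refine ⟨Finset.sdiff_subset.trans (world_subset h), ?_, ?_⟩
  · rw [← hcyc]
    exact nrk_cyclicPart_add_two hS hnul
  · rw [← hcyc]
    exact cyclicPart_cyclicPart hS

/-- `|K_N| + |N| + ℓ₀ = 10`. -/
theorem card_kN {T W N : Finset α} (h : ReducedWorld M T W) (hN : N ∈ serClasses M (T ∪ W)) :
    ((T ∪ W) \ (N ∪ coloopsOf M (T ∪ W))).card + N.card + (coloopsOf M (T ∪ W)).card = 10 := by
  have hsub : N ∪ coloopsOf M (T ∪ W) ⊆ T ∪ W :=
    Finset.union_subset (serClass_subset_world hN) (coloopsOf_subset M _)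
  rw [Finset.card_sdiff_of_subset hsub, Finset.card_union_of_disjoint (disjoint_serClass_coloops hN), card_world h]
  have := Finset.card_le_card hsub
  rw [Finset.card_union_of_disjoint (disjoint_serClass_coloops hN), card_world h] at this
  omega

/-- **The class bounds**: for a series class `N_i` of `K_N` with complement `C_i = K_N ∖ N_i`: `ρ(C_i) + 1 = |C_i|`,
`3 ≤ |C_i|`, `2 ≤ |C_i ∩ W|`, `1 ≤ |C_i ∩ T|`. -/
theorem class_bounds {T W N Ni : Finset α} (h : ReducedWorld M T W) (hr : M.eRank = 7)
    (hN : N ∈ serClasses M (T ∪ W)) (hNW : (N ∩ W).Nonempty)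
    (hNi : Ni ∈ serClasses M ((T ∪ W) \ (N ∪ coloopsOf M (T ∪ W)))) :
    3 ≤ (((T ∪ W) \ (N ∪ coloopsOf M (T ∪ W))) \ Ni).card ∧
      2 ≤ ((((T ∪ W) \ (N ∪ coloopsOf M (T ∪ W))) \ Ni) ∩ W).card ∧
      1 ≤ ((((T ∪ W) \ (N ∪ coloopsOf M (T ∪ W))) \ Ni) ∩ T).card := by
  obtain ⟨hKg, hK2, hcf⟩ := kN_facts h hr hN hNW
  set K := (T ∪ W) \ (N ∪ coloopsOf M (T ∪ W)) with hKdef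
  have hNiK : Ni ⊆ K := by
    obtain ⟨e, -, rfl⟩ := mem_serClasses.1 hNi
    exact (serClass_subset K e).trans (by rw [hcf])
  have hKE : K ⊆ T ∪ W := Finset.sdiff_subset
  -- `C_i` is dependent: `drk K N_i = 1`
  have hd1 : drk M K Ni = 1 :=
    drk_eq_one_of_subset_serClass hKg hNi (Finset.Subset.refl _) (nonempty_of_mem_serClasses hNi)
  have hrk := nrk_add_two_eq_card_add_drk hK2 (Finset.sdiff_subset : K \ Ni ⊆ K)
  rw [Finset.sdiff_sdiff_eq_self hNiK, hd1] at hrk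
  set C := K \ Ni with hCdef
  have hCE : C ⊆ T ∪ W := Finset.sdiff_subset.trans hKE
  have hdep : nrk M C < C.card := by omega
  refine ⟨three_le_card_of_dep h hCE hdep, ?_, ?_⟩
  · -- at least two points of `W`
    by_contra hlt
    have hle : (C ∩ W).card ≤ 1 := by omega
    rcases Nat.lt_or_ge (C ∩ W).card 1 with h0 | h1
    · -- `C ⊆ T` is independent
      have h0 : C ∩ W = ∅ := Finset.card_eq_zero.1 (by omega)
      have hCT : C ⊆ T := by
        intro e he
        rcases Finset.mem_union.1 (hCE he) with hh | hh
        · exact hh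
        · have : e ∈ C ∩ W := Finset.mem_inter.2 ⟨he, hh⟩
          rw [h0] at this
          exact absurd this (Finset.notMem_empty e)
      rw [nrk_subset_T h hCT] at hdep
      omega
    · -- `C ∩ W = {w}`: `w` is spanned by `C ∩ T ⊆ T`
      obtain ⟨w, hw⟩ := Finset.card_eq_one.1 (by omega : (C ∩ W).card = 1)
      have hwC : w ∈ C ∩ W := by rw [hw]; exact Finset.mem_singleton_self w
      rw [Finset.mem_inter] at hwC
      have hCsplit : C = insert w (C ∩ T) := by
        ext e
        simp only [Finset.mem_insert, Finset.mem_inter]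
        constructor
        · intro he
          rcases Finset.mem_union.1 (hCE he) with hh | hh
          · exact Or.inr ⟨he, hh⟩
          · left
            have : e ∈ C ∩ W := Finset.mem_inter.2 ⟨he, hh⟩
            rw [hw, Finset.mem_singleton] at this
            exact this
        · rintro (rfl | ⟨he, -⟩)
          · exact hwC.1
          · exact he
      have hwT : w ∉ C ∩ T := fun hh => Finset.disjoint_left.1 h.disj (Finset.mem_inter.1 hh).2 hwC.2
      have hrkT : nrk M (C ∩ T) = (C ∩ T).card := nrk_subset_T h Finset.inter_subset_right
      have hcard : C.card = (C ∩ T).card + 1 := by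
        conv_lhs => rw [hCsplit]
        rw [Finset.card_insert_of_notMem hwT]
      -- `w ∉ cl(C ∩ T)` would raise the rank
      have hcl : w ∈ M.closure ((C ∩ T : Finset α) : Set α) := by
        by_contra hcl
        have := eRk_insert_eq_succ_of_notMem_closure (h.W_sub hwC.2) hcl
        rw [← hCsplit, ← coe_nrk, ← coe_nrk] at this
        have h3 : nrk M C = nrk M (C ∩ T) + 1 := by exact_mod_cast this
        omega
      exact h.flat w hwC.2 (M.closure_subset_closure (Finset.coe_subset.2 Finset.inter_subset_right) hcl)
  · -- at least one point of `T`: else `C ⊆ W` is independent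
    by_contra hlt
    have h0 : C ∩ T = ∅ := Finset.card_eq_zero.1 (by omega)
    have hCW : C ⊆ W := by
      intro e he
      rcases Finset.mem_union.1 (hCE he) with hh | hh
      · have : e ∈ C ∩ T := Finset.mem_inter.2 ⟨he, hh⟩
        rw [h0] at this
        exact absurd this (Finset.notMem_empty e)
      · exact hh
    rw [nrk_subset_W h hCW] at hdep
    omega

end SevenThree

end PercRepro
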